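import Mathlib
import HarnessLib
import Summits.NavierStokesRegularity.NavierStokesRegularity.Theorems.PoloidalWindowDoorLrcModEntireRidgeHull

/-!
# Item `LrcModEntire` (stmt-NavierStokesRegularity-20428) — (Q3) HOMOGENISATION: along the limit branch of a hull limit, a convergent ridge coefficient is CONSTANT

ns-k2-port-2 g5 (helper prover under the LEAD of item 20428, ns-poloidal-K2-p3 g14; `--supports stmt-NavierStokesRegularity-20428 --as helper`).
Sequel of `…LrcModEntireRidgeHull.exists_hullLimit_branch` (the hull step).  Memo `Cruxes/LrcModEntire/T2B-g14.md` §9 (Q3) / §10: with the ridge data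
`κ = −D²f(γ)(ν,ν)`, `α = D²f(γ)(ν,e_z)`, `β = D²f(γ)(e_z,e_z)` of `f = σ·v₂(−1,·)` along a complete uniformly non-degenerate hot branch `γ ⊂ P₀` (defining equations as in
the LEAD's `…LrcModEntireRidgeClass`), IF the ridge coefficient `s ↦ α(s)²/κ(s) + β(s)` has a limit `L` at `+∞` — e.g. because it is bounded and quasiconvex on a
half-line (`…RidgeClass.quasiconvexOn_ridgeCoeff_of_class` + `…TwistingTHRidgeQuasiconvexTools.exists_tendsto_atTop_of_abs_le`) — then for base points `s_k → +∞`
the hull limit `U` carries the limit branch `Γ` (hot, critical, unit speed, `κ_U ≥ κ₀`) on which **`α_U²/κ_U + β_U ≡ L` at EVERY point `Γ s`, `s ∈ ℝ`**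
(`…RidgeHullTools.eq_lim_of_tendsto_shift`).

* `exists_hullLimit_branch_ridgeCoeff_eq` — the statement above, class clauses / Peakless / critical hot set unfolded as in `exists_hullLimit_branch`.

WHAT THIS IS NOT: not a claim about Navier–Stokes regularity — the «recurrent ridge ⇒ homogeneous second-order ridge data» step of a necessary condition on hypothetical
profiles (bears_on LADDER-NS N0, item 20428 / crux 19708; 20428/19708/27893 OPEN); the iteration over higher orders and the cell (Q4) stay with the LEAD / OPEN.
No summit statement is proved here.
-/

noncomputable section

-- the summit and its single sub-problem share the name (CONVENTIONS §1), as in every Theorems file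
set_option linter.dupNamespace false

namespace Summit.NavierStokesRegularity.NavierStokesRegularity.Theorems.PoloidalWindowDoorLrcModEntireRidgeHullConst

open Set Filter Topology Metric Function
open scoped InnerProductSpace RealInnerProductSpace Laplacian
open Summit.NavierStokesRegularity.NavierStokesRegularity.Theorems.PoloidalWindowDoorLrcModEntireRidgeHullTools
open Summit.NavierStokesRegularity.NavierStokesRegularity.Theorems.PoloidalWindowDoorLrcModEntireRidgeHull

/-- **(Q3) HOMOGENISATION OF THE RIDGE COEFFICIENT ON THE LIMIT BRANCH.**  See the module docstring. -/
theorem exists_hullLimit_branch_ridgeCoeff_eq (C : ℝ) (v : ℝ → EuclideanSpace ℝ (Fin 3) → EuclideanSpace ℝ (Fin 3))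
    (hP : (Literature.Analysis.FluidPDE.HasTypeITimeDecay C v ∧
        ContinuousOn (Function.uncurry v) (Set.Iio (0 : ℝ) ×ˢ Set.univ) ∧
        (∀ s t : ℝ, s < t → t < 0 → ∀ x, v t x =
          Literature.Analysis.UnboundedOperators.heatExtension (v s) (t - s) x -
            Literature.Analysis.FluidPDE.oseenDuhamel 1 s v v t x) ∧
        (∀ t < 0, Literature.Analysis.FluidPDE.VectorCalculus.IsDivFree (v t)) ∧
        (∀ s < 0, ∀ q, ⟪Literature.Analysis.FluidPDE.curl (v s) q, EuclideanSpace.single 2 1⟫_ℝ = 0) ∧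
        v (-1) 0 2 ≠ 0 ∧ (∀ t < 0, ∀ x, Real.sqrt (-t) * |v t x 2| ≤ |v (-1) 0 2|) ∧
        (∀ h : EuclideanSpace ℝ (Fin 3), fderiv ℝ (v (-1)) 0 h 2 = 0) ∧
        (deriv (fun s => v s 0 2) (-1) = v (-1) 0 2 / 2 ∧ v (-1) 0 2 * (Δ (fun q => v (-1) q 2)) 0 ≤ 0)))
    (hK : (∀ (s z₀ σ M : ℝ) (K O : Set (EuclideanSpace ℝ (Fin 3))), s < 0 →
        ((σ = 1 ∨ σ = -1) ∧ IsCompact K ∧ K.Nonempty ∧ (∀ q ∈ K, q 2 = z₀ ∧ σ * v s q 2 = M) ∧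
          IsOpen O ∧ K ⊆ O ∧ (∀ q ∈ O, q 2 = z₀ → σ * v s q 2 ≤ M) ∧
          (∀ q ∈ O, q 2 = z₀ → σ * v s q 2 = M → q ∈ K)) → False))
    (hcrit : ∀ y ∈ {y : EuclideanSpace ℝ (Fin 3) | y 2 = 0 ∧ v (-1) y 2 = v (-1) 0 2}, fderiv ℝ (fun x => v (-1) x 2) y = 0)
    {σ : ℝ} (hσ : σ = 1 ∨ σ = -1)
    {γ : ℝ → EuclideanSpace ℝ (Fin 3)} (hγ2 : ContDiff ℝ 2 γ) (hplane : ∀ s, γ s 2 = 0) (hunit : ∀ s, ‖deriv γ s‖ = 1)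
    (hhot : ∀ s, v (-1) (γ s) 2 = v (-1) 0 2)
    {ν : ℝ → EuclideanSpace ℝ (Fin 3)} (hν : ∀ s, ν s = WithLp.toLp 2 ![-(deriv γ s 1), deriv γ s 0, 0])
    {κ α β : ℝ → ℝ}
    (hκdef : ∀ s, κ s = -(fderiv ℝ (fderiv ℝ (fun y => σ * v (-1) y 2)) (γ s) (ν s) (ν s)))
    (hαdef : ∀ s, α s = fderiv ℝ (fderiv ℝ (fun y => σ * v (-1) y 2)) (γ s) (ν s) (EuclideanSpace.single 2 1))
    (hβdef : ∀ s, β s = fderiv ℝ (fderiv ℝ (fun y => σ * v (-1) y 2)) (γ s) (EuclideanSpace.single 2 1) (EuclideanSpace.single 2 1))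
    {κ₀ : ℝ} (hκ₀ : 0 < κ₀) (hκ : ∀ s, κ₀ ≤ κ s)
    {L : ℝ} (hR : Tendsto (fun s => α s ^ 2 / κ s + β s) atTop (𝓝 L))
    {sq : ℕ → ℝ} (hsq : Tendsto sq atTop atTop) :
    ∃ (φ : ℕ → ℕ) (U : ℝ → EuclideanSpace ℝ (Fin 3) → EuclideanSpace ℝ (Fin 3)) (Γ : ℝ → EuclideanSpace ℝ (Fin 3)), StrictMono φ ∧
      (Literature.Analysis.FluidPDE.HasTypeITimeDecay C U ∧
        ContinuousOn (Function.uncurry U) (Set.Iio (0 : ℝ) ×ˢ Set.univ) ∧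
        (∀ s t : ℝ, s < t → t < 0 → ∀ x, U t x =
          Literature.Analysis.UnboundedOperators.heatExtension (U s) (t - s) x -
            Literature.Analysis.FluidPDE.oseenDuhamel 1 s U U t x) ∧
        (∀ t < 0, Literature.Analysis.FluidPDE.VectorCalculus.IsDivFree (U t)) ∧
        (∀ s < 0, ∀ q, ⟪Literature.Analysis.FluidPDE.curl (U s) q, EuclideanSpace.single 2 1⟫_ℝ = 0) ∧
        U (-1) 0 2 ≠ 0 ∧ (∀ t < 0, ∀ x, Real.sqrt (-t) * |U t x 2| ≤ |U (-1) 0 2|) ∧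
        (∀ h : EuclideanSpace ℝ (Fin 3), fderiv ℝ (U (-1)) 0 h 2 = 0) ∧
        (deriv (fun s => U s 0 2) (-1) = U (-1) 0 2 / 2 ∧ U (-1) 0 2 * (Δ (fun q => U (-1) q 2)) 0 ≤ 0)) ∧
      (∀ (s z₀ σ M : ℝ) (K O : Set (EuclideanSpace ℝ (Fin 3))), s < 0 →
        ((σ = 1 ∨ σ = -1) ∧ IsCompact K ∧ K.Nonempty ∧ (∀ q ∈ K, q 2 = z₀ ∧ σ * U s q 2 = M) ∧
          IsOpen O ∧ K ⊆ O ∧ (∀ q ∈ O, q 2 = z₀ → σ * U s q 2 ≤ M) ∧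
          (∀ q ∈ O, q 2 = z₀ → σ * U s q 2 = M → q ∈ K)) → False) ∧
      U (-1) 0 2 = v (-1) 0 2 ∧
      (∀ t < 0, TendstoLocallyUniformly (fun j x => v t (x + γ (sq (φ j)))) (U t) atTop) ∧
      ContDiff ℝ 1 Γ ∧ Γ 0 = 0 ∧ (∀ s, Γ s 2 = 0) ∧ (∀ s, ‖deriv Γ s‖ = 1) ∧
      (∀ s, Tendsto (fun j => γ (sq (φ j) + s) - γ (sq (φ j))) atTop (𝓝 (Γ s))) ∧
      (∀ s, U (-1) (Γ s) 2 = U (-1) 0 2) ∧ (∀ s, fderiv ℝ (fun x => U (-1) x 2) (Γ s) = 0) ∧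
      -- uniform non-degeneracy and HOMOGENEITY of the ridge coefficient on the limit branch (normal `ν_Γ = (−Γ′₁, Γ′₀, 0)`)
      (∀ s, κ₀ ≤ -(fderiv ℝ (fderiv ℝ (fun y => σ * U (-1) y 2)) (Γ s)
          (WithLp.toLp 2 ![-(deriv Γ s 1), deriv Γ s 0, 0]) (WithLp.toLp 2 ![-(deriv Γ s 1), deriv Γ s 0, 0]))) ∧
      (∀ s, (fderiv ℝ (fderiv ℝ (fun y => σ * U (-1) y 2)) (Γ s) (WithLp.toLp 2 ![-(deriv Γ s 1), deriv Γ s 0, 0]) (EuclideanSpace.single 2 1)) ^ 2 /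
            (-(fderiv ℝ (fderiv ℝ (fun y => σ * U (-1) y 2)) (Γ s)
              (WithLp.toLp 2 ![-(deriv Γ s 1), deriv Γ s 0, 0]) (WithLp.toLp 2 ![-(deriv Γ s 1), deriv Γ s 0, 0]))) +
          fderiv ℝ (fderiv ℝ (fun y => σ * U (-1) y 2)) (Γ s) (EuclideanSpace.single 2 1) (EuclideanSpace.single 2 1) = L) := by
  have hκ' : ∀ s, κ₀ ≤ -(fderiv ℝ (fderiv ℝ (fun y => σ * v (-1) y 2)) (γ s) (ν s) (ν s)) := fun s => by rw [← hκdef]; exact hκ s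
  obtain ⟨φ, U, Γ, hφ, hPU, hKU, hUN, hconv, hΓ1, hΓ0, hΓplane, hΓunit, -, hptγ, -, hptν, hΓhot, hΓcrit, hsecond⟩ :=
    exists_hullLimit_branch C v hP hK hcrit hσ hγ2 hplane hunit hhot hν hκ₀ hκ' sq
  set fU : EuclideanSpace ℝ (Fin 3) → ℝ := fun y => σ * U (-1) y 2 with hfU
  set νΓ : ℝ → EuclideanSpace ℝ (Fin 3) := fun s => WithLp.toLp 2 ![-(deriv Γ s 1), deriv Γ s 0, 0] with hνΓ
  set e₂ : EuclideanSpace ℝ (Fin 3) := EuclideanSpace.single 2 1 with he₂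
  -- the three second-order data converge along the re-based branch points
  have hκlim : ∀ s, Tendsto (fun j => κ (sq (φ j) + s)) atTop (𝓝 (-(fderiv ℝ (fderiv ℝ fU) (Γ s) (νΓ s) (νΓ s)))) := by
    intro s
    have h := (hsecond s _ _ _ _ (hptν s) (hptν s)).neg
    refine h.congr' (Eventually.of_forall fun j => ?_)
    simp only [hκdef]
  have hαlim : ∀ s, Tendsto (fun j => α (sq (φ j) + s)) atTop (𝓝 (fderiv ℝ (fderiv ℝ fU) (Γ s) (νΓ s) e₂)) := by
    intro s
    have h := hsecond s _ _ _ e₂ (hptν s) tendsto_const_nhds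
    refine h.congr' (Eventually.of_forall fun j => ?_)
    simp only [hαdef, he₂]
  have hβlim : ∀ s, Tendsto (fun j => β (sq (φ j) + s)) atTop (𝓝 (fderiv ℝ (fderiv ℝ fU) (Γ s) e₂ e₂)) := by
    intro s
    have h := hsecond s _ _ e₂ e₂ tendsto_const_nhds tendsto_const_nhds
    refine h.congr' (Eventually.of_forall fun j => ?_)
    simp only [hβdef, he₂]
  -- non-degeneracy passes to the limit
  have hκU : ∀ s, κ₀ ≤ -(fderiv ℝ (fderiv ℝ fU) (Γ s) (νΓ s) (νΓ s)) := fun s =>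
    ge_of_tendsto' (hκlim s) fun j => hκ _
  -- the ridge coefficient converges to the limit coefficient ...
  have hRlim : ∀ s, Tendsto (fun j => α (sq (φ j) + s) ^ 2 / κ (sq (φ j) + s) + β (sq (φ j) + s)) atTop
      (𝓝 ((fderiv ℝ (fderiv ℝ fU) (Γ s) (νΓ s) e₂) ^ 2 / (-(fderiv ℝ (fderiv ℝ fU) (Γ s) (νΓ s) (νΓ s))) +
        fderiv ℝ (fderiv ℝ fU) (Γ s) e₂ e₂)) := fun s =>
    (((hαlim s).pow 2).div (hκlim s) (by linarith [hκU s])).add (hβlim s)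
  -- ... and equals `L` by the abstract homogenisation (T3)
  have hconst : ∀ s, (fderiv ℝ (fderiv ℝ fU) (Γ s) (νΓ s) e₂) ^ 2 / (-(fderiv ℝ (fderiv ℝ fU) (Γ s) (νΓ s) (νΓ s))) +
      fderiv ℝ (fderiv ℝ fU) (Γ s) e₂ e₂ = L := by
    intro s
    have h := eq_lim_of_tendsto_shift (Ψ := fun j a => α (sq (φ j) + a) ^ 2 / κ (sq (φ j) + a) + β (sq (φ j) + a))
      (Ψl := fun a => (fderiv ℝ (fderiv ℝ fU) (Γ a) (νΓ a) e₂) ^ 2 / (-(fderiv ℝ (fderiv ℝ fU) (Γ a) (νΓ a) (νΓ a))) +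
        fderiv ℝ (fderiv ℝ fU) (Γ a) e₂ e₂) (a := s)
      hR (hsq.comp hφ.tendsto_atTop) (Eventually.of_forall fun j => rfl) (hRlim s)
    exact h
  exact ⟨φ, U, Γ, hφ, hPU, hKU, hUN, hconv, hΓ1, hΓ0, hΓplane, hΓunit, hptγ, hΓhot, hΓcrit, hκU, hconst⟩

end Summit.NavierStokesRegularity.NavierStokesRegularity.Theorems.PoloidalWindowDoorLrcModEntireRidgeHullConst

end
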